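import Mathlib.Data.ZMod.Basic
import Mathlib.Tactic.Ring
import Mathlib.Tactic.Linarith
import Mathlib.Tactic.LinearCombination
import Mathlib.Tactic.NormNum
import HarnessLib

/-!
# Venture HSemireg — the 2-adic FORBIDDEN certificate of the mobility atlas: `x² − m·y² = 2·z²` has only the zero solution for
# `m ≡ 3, 5 (mod 8)` (ENGINE-W code B, MOBILITY-ATLAS-B.md §2 «law_v2», the `p = 2` certificate) — kernel number theory

HONEST FRAMING. Lean index of the computation cell `pub-hsemireg`, widening group ENGINE-W (code B = the independent second code, seat
`engine-w-2`, gen 10). ELEMENTARY NUMBER THEORY ONLY (a residue computation in `ℤ∕8` and an infinite descent at `2`); the mobility atlas,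
«class `{2}` reached ∕ forbidden» and THEOREM STI enter BY VALUE (docstrings). No abelian variety, sheaf, `Ext` group or semiregularity map
is constructed; nothing here says that HC, HC_CM or HC_AV holds. Theorems only (0 `def`, 0 named fact, 0 `sorry`). Companion of code A's
`SqrtMinusFiveNonNorms.lean` (5-adic descent) and `NonNormObstructions.lean` (odd non-residue primes `ℓ ∣ D`): this file is the
prime `2`, which those do not cover.

SOURCE (the cell's own result, code B): `widen/ENGINE-W/out/probe4/MOBILITY-ATLAS-B.md` §2 (v1.0, engine-w-2 g4; machine leg
`codeB/atlas_scan_B.py` law_v2 → `cmp_atlas_Ew6_AB.json` 204∕204 cells = code A, `cmp_atlas_Ei6_AB.json` 71∕71): the LAW column of the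
atlas is decided by «FORBIDDEN by the local certificate `(m∕p) = −1` [odd `p ∤ m`] or the 2-adic one [`p = 2`, `m ≡ 5 mod 8`, both inert];
ALLOWED by an explicit identity `p·n = a² − m b²`, `n ∈ N(K^×)`». The 2-adic certificate says: for the node field `k′ = ℚ(√m)` with
`m ≡ 5 (mod 8)` (so `2` is INERT in `k′`; «both inert» = also inert in `K = ℚ(ω)`), no class whose determinant ratio is `2` up to
`N(k′^×)·ℚ^{×2}` is reached — because `2·z²` is never a norm `x² − m y²` unless `x = y = z = 0`. What the kernel holds:

* §1 `mod_eight_step` — in `ℤ∕8`: `x² − 5y² = 2z²` or `x² − 3y² = 2z²` forces `4x = 4y = 4z = 0` (all three even), by `decide`;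
  `two_dvd_of_four_mul` — transfer to `ℤ`.
* §2 **`two_dvd_all`** — for `m % 8 ∈ {3, 5}` every integer solution of `x² − m y² = 2 z²` is divisible by `2` in `x`, `y`, `z`;
  `descend` — halving a solution gives a solution.
* §3 **`only_zero_solution`** — for `m % 8 ∈ {3, 5}`, `x² − m y² = 2 z² ⇒ x = y = z = 0` (strong induction on `|x| + |y| + |z|`);
  **`two_not_norm_times_square`** — no solution with `z ≠ 0`: `2 ∉ N(ℚ(√m)^×)·ℚ^{×2}`. (For `m ≡ 5 (8)` this is «`2` inert ⇒ `v₂ ∘ N`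
  even»; for `m ≡ 3 (8)`, where `2` ramifies, it is the sign statement «`−2` may be a norm, `+2` is not», e.g. `N(1 + √3) = −2`.)
* §4 `atlas_fields` — the node fields of record with `m % 8 ∈ {3, 5}`: `m = −3` (`K` itself), `5` (golden: class `{2}` FORBIDDEN, in
  agreement with the atlas' reached list split∕{5}∕{11}), `−11`, `13`, `−19`, `21`, `3`, `11`, `19` — each an instance of §3; and the
  contrast `allowed_identities`: `2 = 1² − (−1)·1²` (`ℚ(i)`), `2 = 2² − 2·1²` (silver `ℚ(√2)`), `2 = 0² − (−2)·1²` (`ℚ(√−2)`),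
  `8 = 1² − (−7)·1²` (`ℚ(√−7)`: `2 = 8∕2²` IS a norm up to squares — class `{2}` reached there, atlas `(7,1,1) → (8⁵,1)`).
WHAT IS NOT HERE: the atlas itself, THEOREM STI, the odd-prime certificates (code A's files), the 3-adic obstruction for `3 ∣ m`
(ONE-FOURIER-FORMULA-B.md §7 REMARK). Tier of the source: machine ×2 across codes (the LAW column, 275 cells) + hand ×1 (B).
-/

namespace Summit.Ventures.HSemireg.TwoAdicNonNorm

/-! ## §1 The residue step in `ℤ∕8` -/

/-- In `ℤ∕8`: `x² − 5y² = 2z²` forces `x`, `y`, `z` all even (`4x = 4y = 4z = 0`). (Squares are `0, 1, 4`; `x, y` odd gives `4`, mixed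
parity gives an odd value, while `2z² ∈ {0, 2}`; then `x, y` even gives `x² − 5y² ∈ {0, 4}`, `= 2z²` forces `z` even.) [kernel, `decide`] -/
theorem mod_eight_step_five : ∀ x y z : ZMod 8, x ^ 2 - 5 * y ^ 2 = 2 * z ^ 2 → 4 * x = 0 ∧ 4 * y = 0 ∧ 4 * z = 0 := by
  decide

/-- In `ℤ∕8`: `x² − 3y² = 2z²` forces `x`, `y`, `z` all even. [kernel, `decide`] -/
theorem mod_eight_step_three : ∀ x y z : ZMod 8, x ^ 2 - 3 * y ^ 2 = 2 * z ^ 2 → 4 * x = 0 ∧ 4 * y = 0 ∧ 4 * z = 0 := by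
  decide

/-- Transfer: `4·x = 0` in `ℤ∕8` means `8 ∣ 4x`, i.e. `2 ∣ x`. [kernel] -/
theorem two_dvd_of_four_mul (x : ℤ) (h : (4 : ZMod 8) * (x : ZMod 8) = 0) : (2 : ℤ) ∣ x := by
  have h' : ((4 * x : ℤ) : ZMod 8) = 0 := by push_cast; exact h
  obtain ⟨k, hk⟩ := (ZMod.intCast_zmod_eq_zero_iff_dvd (4 * x) 8).1 h'
  exact ⟨k, by omega⟩

/-! ## §2 Every solution is even; one descent step -/

/-- **Every solution is divisible by 2**: for `m % 8 = 5` or `m % 8 = 3`, `x² − m y² = 2 z²` implies `2 ∣ x`, `2 ∣ y`, `2 ∣ z`. [kernel] -/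
theorem two_dvd_all (m x y z : ℤ) (hm : m % 8 = 5 ∨ m % 8 = 3) (h : x ^ 2 - m * y ^ 2 = 2 * z ^ 2) :
    (2 : ℤ) ∣ x ∧ (2 : ℤ) ∣ y ∧ (2 : ℤ) ∣ z := by
  have h8 := congrArg (fun t : ℤ => (t : ZMod 8)) h
  push_cast at h8
  have hm8 : (m : ZMod 8) = 5 ∨ (m : ZMod 8) = 3 := by
    rcases hm with hm | hm
    · left
      have e : m = 8 * (m / 8) + 5 := by omega
      rw [e]; push_cast
      have : (8 : ZMod 8) = 0 := by decide
      rw [this]; ring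
    · right
      have e : m = 8 * (m / 8) + 3 := by omega
      rw [e]; push_cast
      have : (8 : ZMod 8) = 0 := by decide
      rw [this]; ring
  have key : 4 * (x : ZMod 8) = 0 ∧ 4 * (y : ZMod 8) = 0 ∧ 4 * (z : ZMod 8) = 0 := by
    rcases hm8 with e | e
    · rw [e] at h8; exact mod_eight_step_five _ _ _ h8
    · rw [e] at h8; exact mod_eight_step_three _ _ _ h8
  exact ⟨two_dvd_of_four_mul x key.1, two_dvd_of_four_mul y key.2.1, two_dvd_of_four_mul z key.2.2⟩

/-- **One descent step**: halving a solution gives a solution of the same equation. [kernel] -/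
theorem descend (m x₁ y₁ z₁ : ℤ) (h : (2 * x₁) ^ 2 - m * (2 * y₁) ^ 2 = 2 * (2 * z₁) ^ 2) :
    x₁ ^ 2 - m * y₁ ^ 2 = 2 * z₁ ^ 2 := by
  have h' : (4 : ℤ) * (x₁ ^ 2 - m * y₁ ^ 2) = 4 * (2 * z₁ ^ 2) := by linear_combination h
  exact mul_left_cancel₀ (by norm_num) h'

/-! ## §3 The descent: only the zero solution -/

/-- **`x² − m y² = 2 z²` has only the zero solution for `m ≡ 3, 5 (mod 8)`** (infinite descent at `2`). [kernel] -/
theorem only_zero_solution (m : ℤ) (hm : m % 8 = 5 ∨ m % 8 = 3) :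
    ∀ x y z : ℤ, x ^ 2 - m * y ^ 2 = 2 * z ^ 2 → x = 0 ∧ y = 0 ∧ z = 0 := by
  suffices H : ∀ n : ℕ, ∀ x y z : ℤ, x.natAbs + y.natAbs + z.natAbs ≤ n →
      x ^ 2 - m * y ^ 2 = 2 * z ^ 2 → x = 0 ∧ y = 0 ∧ z = 0 by
    intro x y z h; exact H _ x y z le_rfl h
  intro n
  induction n using Nat.strong_induction_on with
  | _ n ih =>
    intro x y z hn h
    obtain ⟨⟨x₁, rfl⟩, ⟨y₁, rfl⟩, ⟨z₁, rfl⟩⟩ := two_dvd_all m x y z hm h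
    have h' := descend m x₁ y₁ z₁ h
    by_cases h0 : x₁ = 0 ∧ y₁ = 0 ∧ z₁ = 0
    · obtain ⟨rfl, rfl, rfl⟩ := h0; simp
    · have hmeas : x₁.natAbs + y₁.natAbs + z₁.natAbs < n := by
        have e1 : ((2 : ℤ) * x₁).natAbs = 2 * x₁.natAbs := by rw [Int.natAbs_mul]; rfl
        have e2 : ((2 : ℤ) * y₁).natAbs = 2 * y₁.natAbs := by rw [Int.natAbs_mul]; rfl
        have e3 : ((2 : ℤ) * z₁).natAbs = 2 * z₁.natAbs := by rw [Int.natAbs_mul]; rfl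
        rw [e1, e2, e3] at hn
        have hpos : 0 < x₁.natAbs + y₁.natAbs + z₁.natAbs := by
          by_contra hle
          push Not at hle
          have : x₁.natAbs = 0 ∧ y₁.natAbs = 0 ∧ z₁.natAbs = 0 := by omega
          exact h0 ⟨Int.natAbs_eq_zero.1 this.1, Int.natAbs_eq_zero.1 this.2.1, Int.natAbs_eq_zero.1 this.2.2⟩
        omega
      obtain ⟨hx, hy, hz⟩ := ih _ hmeas x₁ y₁ z₁ le_rfl h'
      exact absurd ⟨hx, hy, hz⟩ h0

/-- **`2 ∉ N(ℚ(√m)^×)·ℚ^{×2}` for `m ≡ 3, 5 (mod 8)`**: no solution of `x² − m y² = 2 z²` has `z ≠ 0` — the atlas' 2-adic FORBIDDEN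
certificate for class `{2}` («`p = 2`, `m ≡ 5 mod 8`»; the `m ≡ 3` half is the ramified sign statement). [kernel] -/
theorem two_not_norm_times_square (m : ℤ) (hm : m % 8 = 5 ∨ m % 8 = 3) (x y z : ℤ) (hz : z ≠ 0) :
    x ^ 2 - m * y ^ 2 ≠ 2 * z ^ 2 := by
  intro h
  exact hz (only_zero_solution m hm x y z h).2.2

/-! ## §4 The node fields of record -/

/-- **The atlas fields with `m % 8 ∈ {3, 5}`**: `m = −3, 5, −11, 13, −19, 21` (`≡ 5`) and `3, 11, 19` (`≡ 3`) — in each, `x² − m y² = 2z²`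
only trivially (golden field `ℚ(√5)`: class `{2}` FORBIDDEN; `ℚ(√−3) = K`; …). [kernel] -/
theorem atlas_fields (x y z : ℤ) (hz : z ≠ 0) :
    x ^ 2 - (-3) * y ^ 2 ≠ 2 * z ^ 2 ∧ x ^ 2 - 5 * y ^ 2 ≠ 2 * z ^ 2 ∧ x ^ 2 - (-11) * y ^ 2 ≠ 2 * z ^ 2 ∧
      x ^ 2 - 13 * y ^ 2 ≠ 2 * z ^ 2 ∧ x ^ 2 - (-19) * y ^ 2 ≠ 2 * z ^ 2 ∧ x ^ 2 - 21 * y ^ 2 ≠ 2 * z ^ 2 ∧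
      x ^ 2 - 3 * y ^ 2 ≠ 2 * z ^ 2 ∧ x ^ 2 - 11 * y ^ 2 ≠ 2 * z ^ 2 ∧ x ^ 2 - 19 * y ^ 2 ≠ 2 * z ^ 2 := by
  refine ⟨two_not_norm_times_square (-3) (by norm_num) x y z hz, two_not_norm_times_square 5 (by norm_num) x y z hz,
    two_not_norm_times_square (-11) (by norm_num) x y z hz, two_not_norm_times_square 13 (by norm_num) x y z hz,
    two_not_norm_times_square (-19) (by norm_num) x y z hz, two_not_norm_times_square 21 (by norm_num) x y z hz,
    two_not_norm_times_square 3 (by norm_num) x y z hz, two_not_norm_times_square 11 (by norm_num) x y z hz,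
    two_not_norm_times_square 19 (by norm_num) x y z hz⟩

/-- **The ALLOWED contrast** (explicit identities `p·n = a² − m b²` of the law): `2 = 1² − (−1)·1²` (`ℚ(i)`), `2 = 2² − 2·1²`
(`ℚ(√2)`), `2 = 0² − (−2)·1²` (`ℚ(√−2)`), `2·2² = 1² − (−7)·1²` (`ℚ(√−7)`: `2` IS a norm up to squares), and the ramified-sign examples
`−2 = 1² − 3·1²`, `−2 = 3² − 11·1²`, `−2 = 13² − 19·3²` (`−2`, not `+2`, is a norm for `m = 3, 11, 19`). [kernel, `norm_num`] -/
theorem allowed_identities :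
    (2 : ℤ) = 1 ^ 2 - (-1) * 1 ^ 2 ∧ (2 : ℤ) = 2 ^ 2 - 2 * 1 ^ 2 ∧ (2 : ℤ) = 0 ^ 2 - (-2) * 1 ^ 2 ∧
      (2 : ℤ) * 2 ^ 2 = 1 ^ 2 - (-7) * 1 ^ 2 ∧
      (-2 : ℤ) = 1 ^ 2 - 3 * 1 ^ 2 ∧ (-2 : ℤ) = 3 ^ 2 - 11 * 1 ^ 2 ∧ (-2 : ℤ) = 13 ^ 2 - 19 * 3 ^ 2 := by
  norm_num

end Summit.Ventures.HSemireg.TwoAdicNonNorm
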